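import Mathlib
import HarnessLib
import HarnessLib.Audit
import Summits.HubbardSuperconductivity.Statement
import HarnessLib.Audit.Status.Attr

/-!
Route: NodalDiracTwist

DORMANT since 2026-08-26T10:53:42Z (reconciler: no traction for 8.3 d (last activity item-evidence-added at 2026-08-18T03:03:47Z); parked, not closed — `ledger route dormant route-HubbardSuperconductivity-NodalDiracTwist --off` to react) — unstaffed, not closed; items shared with open routes are served there. `ledger route dormant <id> --off` reactivates.

Route NodalDiracTwist — realises idea card nodal-dirac-points-twist-space ("nodes are sign changes
of the ground state").

OBJECT. The spin-twisted Hubbard torus in the boost gauge, H_L(U,φ) = −Σ_{x,μ,σ} (e^{iσφ_μ/L}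
c†_{xσ}c_{x+e_μ,σ} + h.c.) + U Σ_x n_{x↑}n_{x↓}, σ = ±1 for ↑/↓, φ ∈ T² (inlined in every signature;
TwistAtZero: H_L(U,0) = hubbardTorus 2 L 1 U). H_L(U,φ) conserves N_↑, N_↓, so the summit's (N_L,
S^z=0) sector is kept, and it commutes with the ANTIUNITARY T = (complex conjugation)∘(spin flip
↑↔↓), T² = +1: the sector ground-state line bundle over twist space is REAL, so its holonomy around
any loop on which the ground state is non-degenerate is a SIGN (RealCyclicOverlap,
DiskTrivialHolonomy) — quantised with no gap hypothesis anywhere except on the loop.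

THESIS X (it suffices to show): X := NodalDiracWeakCoupling ∧ BridgeNodalToDWave, where
* NodalDirac(U,δ): there is κ ∈ (0,π) (the node momentum) such that for every ε > 0 and all large
even L with dist(Lκ, πℤ) ≥ ε, the (N_L,0)-sector ground state of H_L(U,φ) is degenerate at EXACTLY
four twists of the cell (−π,π]², namely (±c_L, ±c_L) on the DIAGONALS with |cos c_L − cos Lκ| ≤ ε,
and the cyclic overlap product of ground states around each of them is NEGATIVE (ℤ₂ holonomy −1: the
ground state changes sign when a node is encircled);
* NodalDiracWeakCoupling (crux, rank 2): ∀ U₀>0 ∃ U∈(0,U₀) ∃ δ∈[1/10,3/10], NodalDirac(U,δ);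
* BridgeNodalToDWave (crux, rank 4): ∃ U₀>0 ∀ U∈(0,U₀) ∀ δ∈[1/10,3/10], NodalDirac(U,δ) → every
normalised (N_L,0)-sector ground-state sequence of hubbardTorus 2 L 1 U has even-side d_{x²−y²}
pair-field LRO (the Statement's conclusion verbatim).
Assembly (rank 1, pure logic, checked rc0 in the planner's Sketch): NodalDiracWeakCoupling →
SourcedDiracPersistence → BridgeNodalToDWave → HubbardSuperconductivity (take U₀ from the bridge,
(U,δ) from crux 1; [1/10,3/10] ⊂ (0,1/2)).
One-line Lean form of X: `NodalDiracWeakCoupling ∧ BridgeNodalToDWave` over the route's decls (all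
constants are existing Literature.MathematicalPhysics.QuantumLattice /
Literature.Probability.LatticeModels declarations: FermionTorus, Orb, Fock, creation, annihilation,
orb, numberOp, totalNumber, HubbardWave0.spinZ, IsGroundStateInSector, Matrix.minEnergyOn,
hubbardTorus, pairFieldCorr, dWaveFormFactor, torusPullback, halfOpenBox, HasLongRangeOrder; plus
Mathlib toLex/ofLex/Function.update/finRotate/Complex.exp).

CONTROLLED RUNG (crux, rank 3) SourcedDiracPersistence: the same Dirac package for the
d-wave-SOURCED grand-canonical family H_L(U,φ) − μ₀N − h(P_φ + P_φ†), P_φ = Σ_k ĝ(k+φ/L)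
c_{k↑}c_{−k↓} the consistently twisted n.n. d-wave pair field, in ker S^z, for every h∈(0,1),
μ₀∈[−3,−1] and 0 ≤ U < U₀(h,μ₀): interacting nodal Dirac points persist (Giuliani–Mastropietro-type
constructive RG for 2D lattice Dirac fermions is the intended engine). At U = 0 this is the BdG
CALIBRATION (support TwistCalibrationBdG, provable now: exact positions cos c_L =
cos(L·arccos(−μ₀/4)) for every non-resonant L ≥ 3, holonomy −1 from the 2×2 real Möbius block).

Rationale: WHY THIS LINE. Every S-side route so far reads ENERGIES or CORRELATORS; this one reads the GEOMETRY
OF DEGENERACIES of the fixed-N sector ground state over the torus of opposite spin twists. Reality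
of H_L(U,φ) under T = K∘(↑↔↓) (T²=+1) makes the GS bundle real, so loop holonomies are signs
(Hatsugai2006 transplanted from gapped to nodal), and von Neumann–Wigner codimension 2 makes conical
crossings on the 2-torus STABLE objects that interactions can move but not open. For a nodal singlet
superconductor the crossings sit at L×(node) mod 2π — four points on the cell DIAGONALS for
d_{x²−y²} (axes for d_xy, a codimension-one net for a Fermi liquid, nothing for a full gap): a
quantised, gap-size-independent fingerprint of the generic (T-invariant, nodal) regime that the
chiral/Chern cards cannot see (SenthilMarstonFisher1999, ReadGreen2000 need d+id). Imported areas: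
real line bundles/Berry holonomy (NiuThoulessWu1985, FukuiHatsugaiSuzuki2005), one-body node
topology (Volovik2007, Sato2006, Beri2010), constructive RG for lattice Dirac fermions
(GiulianiMastropietro2009, GiulianiEtAl2016) for the sourced rung. Catalogue entries used:
spectral/operator reformulation + topological invariant; certified computation only as refuter
instrument (ED over a twist grid, L ≤ 6).
RANKED CRUXES. (2) NodalDiracWeakCoupling — the structural claim for the pure model at arbitrarily
weak U, some δ∈[0.1,0.3]; hardest (needs the self-generated d-wave state with spectral control at
scale 1/L; L₀ ~ ξ ~ e^{C/U²}). (3) SourcedDiracPersistence — same package with a pair source h>0,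
0≤U<U₀(h): the theorem-grade rung (interacting Dirac fermions à la graphene); its failure kills the
mechanism before h→0 is even asked. (4) BridgeNodalToDWave — classification: diagonal Dirac quartet
with holonomy −1 at weak coupling ⇒ d-wave pair-field LRO for every GS; folklore-grade, named
competitor = nodal liquid (BalentsFisherNayak1998). Support (rank 9): TwistCalibrationBdG (U=0,
exact, provable now), RealCyclicOverlap, DiskTrivialHolonomy (holonomy −1 certifies an enclosed
degeneracy — the instrument), TwistAtZero.
KILL CRITERIA. SourcedDiracPersistence refuted (e.g. interactions produce a degeneracy net, or
holonomy +1, already at h>0) → close. TwistCalibrationBdG refuted (locus not the diagonal quartet /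
sign not −1 at U=0) → the dictionary is wrong → close. Bridge refuted by an explicit weak-coupling
nodal state without LRO satisfying NodalDirac → pivot to a conditional bridge or close. ED evidence
(U=2–4, L=4,6, small h) showing an axial or 8-point pattern where DMRG sees d_{x²−y²} → retire the
pattern claim.
NOT DECOMPOSED YET. The h→0 passage from crux 3 to crux 2 (where WeakCouplingCeiling bites); the
resonant-L set dist(Lκ,πℤ)<ε (cf. card nodes-meet-the-grid) — NodalDirac is deliberately silent
there and the bridge must absorb it; cone slopes (not needed for the sign); number projection of the
sourced state.
NOVELTY and BARRIERS: see the route header sections (filed with --novelty/ --barriers).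

Novelty: Searched this pass: lit search --hybrid "twisted boundary conditions Berry phase Dirac point
interacting level crossing ground state" (held hits: textbooks only — Moessner–Moore 2021, Fradkin
2013, Altland–Simons), lit vsearch ×2 (same), lit galaxy --star all/pdf ("quantized Berry phase",
"nodal liquid", "Hubbard model on the honeycomb lattice": no many-body twist-holonomy-of-nodal-SC
hit), lit frontier HubbardSuperconductivity --since 2020 (30 rows, none on twist bundles), the
card's own audit (refuter-novelty-audit-12: Volovik/Sato/Béri one-body ℤ₂ node charge; Hatsugai2006
many-body ℤ₂ Berry phase, gapped; KarakuzuSekiSorella2018 TABC folklore 'gap closes when the shifted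
grid hits a node'; VarneyEtAl2011 gap closings in twist space for interacting topological
transitions). Delta: (i) the REAL sector-GS bundle of a NUMBER-CONSERVING nodal singlet SC over the
spin-twist torus, with locus = L×node and holonomy −1 per node, as a typed finite-L statement; (ii)
the diagonal-vs-axial position test as a B1g/B2g discriminator needing no correlator; (iii) new here
vs the card: the sourced rung tied to Giuliani–Mastropietro Dirac-fermion RG, the non-resonance
formulation, and the nodal liquid named as the bridge's failure mode. Grade expected:
new-combination.  [refs: Hatsugai2006, KarakuzuSekiSorella2018, VarneyEtAl2011]

Barriers (technique_class: GS-holonomy spin-twist constructive-RG Bogoliubov-de-Gennes): Literature.Barriers.HubbardSuperconductivity.WeakCouplingCeiling: APPLIES to crux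
NodalDiracWeakCoupling (L0 ~ coherence length ~ e^{C/U^2}; no convergent expansion reaches the
self-generated d-wave state) — NOT evaded; the bet is that the VALUE (-1) and the locus
DIMENSION/PATTERN are U-independent once pairing exists, and crux SourcedDiracPersistence lives at
fixed source h>0 where the Cooper channel is cut off (no Cooper logarithm), reachable by
Giuliani–Mastropietro-type Dirac-fermion RG (GiulianiMastropietro2009, GiulianiEtAl2016).
Literature.Barriers.HubbardSuperconductivity.PerturbativeInvisibilityOfPairing: APPLIES to any
attempt to see the cone APERTURE (v_Delta ~ e^{-1/(alpha rho^2 U^2)}) perturbatively; EVADED by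
design for what is claimed: a sign and a point pattern carry no scale; numerics at L<=6 see
positions, not slopes (said in why-might-fail).
Literature.Barriers.HubbardSuperconductivity.LROForcesLowLyingStates: consistent and used — N is
fixed so the Koma–Tasaki pair tower lives in other sectors; the low-lying states the route WANTS are
the nodal two-quasiparticle states touching E0 at the Dirac points; other O(1/L) states (two-phonon,
P=0) cannot remove a holonomy -1 point (real family, codimension 2), only move it.
Literature.Barriers.HubbardSuperconductivity.GeneralizedHartreeFockNoPairing: not contradicted —
BdG/quasi-free states enter only as the U=0, h>0 calibration with pairing put in by the source
(TwistCalibrationBdG); no bare-U gap equation is use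

History (route lifecycle, newest last):
- 2026-08-15T16:13:22Z · rev 2: restated NodalDiracWeakCoupling (stmt-HubbardSuperconductivity-1621) — repair (route-repair seat, per retriage 11:58Z + refuters d39967b4/2ff06673/7a7407df): stmt-1621 NodalDiracWeakCoupling restated 1:1 inserting 'Real.cos κ ≠ 0' (planner-rbadge-HubbardSuperconductivity-NodalD-ec5b2c6a-g2-0)
- 2026-08-15T16:14:09Z · rev 3: restated BridgeNodalToDWave (stmt-HubbardSuperconductivity-1623) — repair (route-repair seat): stmt-1623 BridgeNodalToDWave restated 1:1 — the NodalDirac(U,δ) hypothesis package gets the identical insertion 'Real.cos κ ≠ 0' as (planner-rbadge-HubbardSuperconductivity-NodalD-ec5b2c6a-g2-0)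
- 2026-08-26T10:53:42Z · DORMANT — reconciler: no traction for 8.3 d (last activity item-evidence-added at 2026-08-18T03:03:47Z); parked, not closed — `ledger route dormant route-HubbardSupercond (operator:999:2533624)

sub-problem: HubbardSuperconductivity · status: dormant · opened planner-plancard-HubbardSuperconductivity-Hub-52301e10-0 2026-08-15T10:57:41Z · rev 5 · ledger route-HubbardSuperconductivity-NodalDiracTwist
GENERATED by the gate from the ledger (D-0016/17). Provers cite these decls: `theorem foo : Summit.HubbardSuperconductivity.HubbardSuperconductivity.Theses.NodalDiracTwist.<Decl> := …` in Summits/HubbardSuperconductivity/HubbardSuperconductivity/Theorems/<Name>.lean.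
-/

namespace Summit.HubbardSuperconductivity.HubbardSuperconductivity.Theses.NodalDiracTwist

open scoped BigOperators Topology Manifold Classical MeasureTheory ProbabilityTheory Matrix InnerProductSpace ComplexConjugate ContinuousMap
open Filter Set Function TopologicalSpace MeasureTheory

attribute [summit_statement] _root_.HubbardSuperconductivity

open Literature.Hubbard

-- earlier NodalDiracWeakCoupling (stmt-HubbardSuperconductivity-1621, replaced 2026-08-15T16:13:22Z -> stmt-HubbardSuperconductivity-10370): retired by None — ∀ U₀ : ℝ, 0 < U₀ → ∃ U ∈ Set.Ioo (0 : ℝ) U₀, ∃ δ ∈ Set.Icc (1 / 10 : ℝ) (3 / 10), (∃ κ : ℝ, 0 < κ ∧ κ < Real.pi ∧ ∀ ε : ℝ, 0 < ε → ∃ L₀ : ℕ, ∀ (L : ℕ) [NeZero L], Even L → L₀ ≤ L → (∀ m : ℤ, ε ≤ |L * κ - m * Real.pi|) → let sh : Literature.Mat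
/-- item stmt-HubbardSuperconductivity-10370 · crux · rank 2 · open · by planner
why it might fail: L0 ~ xi ~ e^{C/U^2} (WeakCouplingCeiling): needs the self-generated d-wave GS with spectral control at scale 1/L on infinitely many non-resonant even L (cos κ ≠ 0). One extra accidental GS crossing in the cell, or an O(1) offset c_L − Lκ, kills the exact locus clause; d_xy wins for n<0.6 (RKS2010).
sources: RaghuKivelsonScalapino2010, ArovasBergKivelsonRaghu2022, Hatsugai2006, Sato2006, Beri2010, Volovik2007
[crux] NodalDirac(U,δ) at arbitrarily weak repulsion for some δ∈[1/10,3/10]: ∀U₀>0 ∃U∈(0,U₀) ∃δ: ∃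
node momentum κ∈(0,π) such that ∀ε>0, for all large EVEN L off the resonant set (dist(Lκ,πℤ)≥ε), the
(N_L,S^z=0)-sector ground state (N_L=2⌊(1−δ)L²/2⌋) of the boost-gauge spin-twisted torus
H_L(U,φ)=−Σ_{x,μ,σ}(e^{iσφ_μ/L}c†_{xσ}c_{x+e_μ,σ}+h.c.)+UΣn↑n↓ (inlined; =hubbardTorus 2 L 1 U at
φ=0, item TwistAtZero) is degenerate at EXACTLY the four diagonal twists (±c_L,±c_L) of the cell
(−π,π]², with |cos c_L−cos Lκ|≤ε (positions track L×node), and around each of them the cyclic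
overlap product Π_i⟨ψ_i,ψ_{i+1}⟩ of unit sector ground states on a circle of radius r<min(c,π−c)
with n≥n₀ vertices has NEGATIVE real part (ℤ₂ holonomy −1: the ground state changes sign when a node
is encircled; real by RealCyclicOverlap, phase choices cancel cyclically). Physics: d_{x²−y²} nodes
(±κ,±κ) ⇒ Dirac points of the real GS bundle at L×node mod 2π; d_xy would give axial points, a Fermi
liquid a codimension-1 net, a full gap nothing. Sources: RaghuKivelsonScalapino2010 §III;
ArovasBergKivelsonRaghu2022 §5.1; Hatsugai2006; Sato2006; Beri2010; Volovik2007; card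
nodes-meet-the-grid (resonant L). -/
@[route_item "route-HubbardSuperconductivity-NodalDiracTwist", crux]
def NodalDiracWeakCoupling : Prop :=
  ∀ U₀ : ℝ, 0 < U₀ → ∃ U ∈ Set.Ioo (0 : ℝ) U₀, ∃ δ ∈ Set.Icc (1 / 10 : ℝ) (3 / 10), (∃ κ : ℝ, 0 < κ ∧ κ < Real.pi ∧ Real.cos κ ≠ 0 ∧ ∀ ε : ℝ, 0 < ε → ∃ L₀ : ℕ, ∀ (L : ℕ) [NeZero L], Even L → L₀ ≤ L → (∀ m : ℤ, ε ≤ |L * κ - m * Real.pi|) → let sh : Literature.MathematicalPhysics.QuantumLattice.FermionTorus 2 L → Fin 2 → Literature.MathematicalPhysics.QuantumLattice.FermionTorus 2 L := fun x μ => toLex (Function.update (ofLex x) μ (ofLex x μ + 1)); let a := fun (x : Literature.MathematicalPhysics.QuantumLattice.FermionTorus 2 L) (σ : Fin 2) => Literature.MathematicalPhysics.QuantumLattice.annihilation (Literature.MathematicalPhysics.QuantumLattice.orb x σ); let H := fun φ : Fin 2 → ℝ => -(∑ x : Literature.MathematicalPhysics.QuantumLattice.FermionTorus 2 L, ∑ μ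 : Fin 2, ∑ σ : Fin 2, (Complex.exp (Complex.I * (((-1 : ℝ) ^ (σ : ℕ) * φ μ / L : ℝ) : ℂ)) • (Matrix.conjTranspose (a x σ) * a (sh x μ) σ) + Complex.exp (-(Complex.I * (((-1 : ℝ) ^ (σ : ℕ) * φ μ / L : ℝ) : ℂ))) • (Matrix.conjTranspose (a (sh x μ) σ) * a x σ))) + (U : ℂ) • ∑ x : Literature.MathematicalPhysics.QuantumLattice.FermionTorus 2 L, Literature.MathematicalPhysics.QuantumLattice.numberOp x 0 * Literature.MathematicalPhysics.QuantumLattice.numberOp x 1; ∃ c : ℝ, 0 < c ∧ c < Real.pi ∧ |Real.cos c - Real.cos (L * κ)| ≤ ε ∧ (∀ φ : Fin 2 → ℝ, φ 0 ∈ Set.Ioc (-Real.pi) Real.pi → φ 1 ∈ Set.Ioc (-Real.pi) Real.pi → ((∃ ψ₁ ψ₂, Literature.MathematicalPhysics.QuantumLattice.IsGroundStateInSector (H φ) (2 * ⌊(1 - δ) * (L : ℝ) ^ 2 / 2⌋₊) 0 ψ₁ ∧ Literature.MathematicalPhysics.QuantumLattice.IsGroundStateInSector (H φ) (2 * ⌊(1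 - δ) * (L : ℝ) ^ 2 / 2⌋₊) 0 ψ₂ ∧ star ψ₁ ⬝ᵥ ψ₂ = 0) ↔ (|φ 0| = c ∧ |φ 1| = c))) ∧ (∀ p : Fin 2 → ℝ, |p 0| = c → |p 1| = c → ∀ r : ℝ, 0 < r → r < min c (Real.pi - c) → ∃ n₀ : ℕ, ∀ n ≥ n₀, ∀ ψ : Fin n → (Finset (Literature.MathematicalPhysics.QuantumLattice.Orb (Literature.MathematicalPhysics.QuantumLattice.FermionTorus 2 L)) → ℂ), (∀ i : Fin n, Literature.MathematicalPhysics.QuantumLattice.IsGroundStateInSector (H (fun ν : Fin 2 => p ν + r * (if ν = 0 then Real.cos (2 * Real.pi * (i : ℕ) / n) else Real.sin (2 * Real.pi * (i : ℕ) / n)))) (2 * ⌊(1 - δ) * (L : ℝ) ^ 2 / 2⌋₊) 0 (ψ i) ∧ star (ψ i) ⬝ᵥ ψ i = 1) → (∏ i : Fin n, star (ψ i) ⬝ᵥ ψ (finRotate n i)).re < 0))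

/-- item stmt-HubbardSuperconductivity-1622 · crux · rank 3 · open · by planner
why it might fail: GM2009-type RG controls infinite-volume correlations, not finite-L spectra: 'ker-S^z GS degenerate at EXACTLY four twists, unique elsewhere, holonomy −1' is a two-lowest-level claim at gap scale ~h/L, uniform in φ, with U fixed ≫ 1/L; one stray P≠0 level or nucleated cone pair at large L kills it.
sources: GiulianiMastropietro2009, GiulianiEtAl2016, KarakuzuSekiSorella2018, FukuiHatsugaiSuzuki2005, Hatsugai2006
[crux] Controlled rung (interacting Dirac points persist): for the grand-canonical d-wave-SOURCED
twisted family H_L(U,φ)−μ₀N−h(P_φ+P_φ†) restricted to ker S^z, where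
P_φ=Σ_xΣ_μ(−1)^μ[e^{−iφ_μ/L}c_{x↑}c_{x+e_μ,↓}+e^{+iφ_μ/L}c_{x+e_μ,↑}c_{x↓}]=Σ_k
2(cos(k_x+φ_x/L)−cos(k_y+φ_y/L))c_{k↑}c_{−k↓} is the CONSISTENTLY twisted n.n. d-wave pair field
(pairs stay at zero momentum under opposite spin twists; an untwisted pair term would Doppler-shift
them and turn the locus into arcs): ∀h∈(0,1) ∀μ₀∈[−3,−1] ∃U₀>0 ∀U∈[0,U₀) the same Dirac package
holds (∃κ∈(0,π), ∀ε>0, all large L with dist(Lκ,πℤ)≥ε: GS in ker S^z degenerate exactly at (±c,±c),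
|cos c−cos Lκ|≤ε, holonomy −1). At U=0 this is TwistCalibrationBdG with κ=arccos(−μ₀/4) exactly.
Intended engine: constructive multiscale RG for weakly interacting 2D lattice Dirac fermions
(half-filled honeycomb Hubbard: GiulianiMastropietro2009 Thm 1; Haldane–Hubbard critical line:
GiulianiEtAl2016), transplanted to Bogoliubov nodal quasiparticles with U(1) explicitly broken by h,
so no Cooper channel; antiunitary symmetry T'=K∘F∘(−1)^{N↑} (T'²=+1 on even N) keeps the bundle
real. Its failure (net instead of points, or sign +1, already at h>0) kills th -/
@[route_item "route-HubbardSuperconductivity-NodalDiracTwist", crux]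
def SourcedDiracPersistence : Prop :=
  ∀ h : ℝ, 0 < h → h < 1 → ∀ μ₀ ∈ Set.Icc (-3 : ℝ) (-1), ∃ U₀ : ℝ, 0 < U₀ ∧ ∀ U ∈ Set.Ico (0 : ℝ) U₀, ∃ κ : ℝ, 0 < κ ∧ κ < Real.pi ∧ ∀ ε : ℝ, 0 < ε → ∃ L₀ : ℕ, ∀ (L : ℕ) [NeZero L], L₀ ≤ L → (∀ m : ℤ, ε ≤ |L * κ - m * Real.pi|) → let sh : Literature.MathematicalPhysics.QuantumLattice.FermionTorus 2 L → Fin 2 → Literature.MathematicalPhysics.QuantumLattice.FermionTorus 2 L := fun x μ => toLex (Function.update (ofLex x) μ (ofLex x μ + 1)); let a := fun (x : Literature.MathematicalPhysics.QuantumLattice.FermionTorus 2 L) (σ : Fin 2) => Literature.MathematicalPhysics.QuantumLattice.annihilation (Literature.MathematicalPhysics.QuantumLattice.orb x σ); let H₀ := fun φ : Fin 2 → ℝ => -(∑ x : Literature.MathematicalPhysics.QuantumLattice.FermionTorus 2 L, ∑ μ : Fin 2, ∑ σ : Fin 2, (Complex.exp (Complex.I * (((-1 : ℝ) ^ (σ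 : ℕ) * φ μ / L : ℝ) : ℂ)) • (Matrix.conjTranspose (a x σ) * a (sh x μ) σ) + Complex.exp (-(Complex.I * (((-1 : ℝ) ^ (σ : ℕ) * φ μ / L : ℝ) : ℂ))) • (Matrix.conjTranspose (a (sh x μ) σ) * a x σ))) + (U : ℂ) • ∑ x : Literature.MathematicalPhysics.QuantumLattice.FermionTorus 2 L, Literature.MathematicalPhysics.QuantumLattice.numberOp x 0 * Literature.MathematicalPhysics.QuantumLattice.numberOp x 1; let P := fun φ : Fin 2 → ℝ => ∑ x : Literature.MathematicalPhysics.QuantumLattice.FermionTorus 2 L, ∑ μ : Fin 2, ((-1 : ℂ) ^ (μ : ℕ)) • (Complex.exp (-(Complex.I * ((φ μ / L : ℝ) : ℂ))) • (a x 0 * a (sh x μ) 1) + Complex.exp (Complex.I * ((φ μ / L : ℝ) : ℂ)) • (a (sh x μ) 0 * a x 1)); let H := fun φ : Fin 2 → ℝ => H₀ φ - (μ₀ : ℂ) • Literature.MathematicalPhysics.QuantumLattice.totalNumber - (h : ℂ) • (P φ + Matrix.conjTranspose (P φ)); let K := LinearMap.ker (Matrix.toLin' (Literature.MathematicalPhysics.QuantumLattice.HubbardWave0.spinZ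 : Matrix (Finset (Literature.MathematicalPhysics.QuantumLattice.Orb (Literature.MathematicalPhysics.QuantumLattice.FermionTorus 2 L))) (Finset (Literature.MathematicalPhysics.QuantumLattice.Orb (Literature.MathematicalPhysics.QuantumLattice.FermionTorus 2 L))) ℂ)); ∃ c : ℝ, 0 < c ∧ c < Real.pi ∧ |Real.cos c - Real.cos (L * κ)| ≤ ε ∧ (∀ φ : Fin 2 → ℝ, φ 0 ∈ Set.Ioc (-Real.pi) Real.pi → φ 1 ∈ Set.Ioc (-Real.pi) Real.pi → ((∃ ψ₁ ψ₂, (ψ₁ ∈ K ∧ ψ₁ ≠ 0 ∧ Matrix.mulVec (H φ) ψ₁ = ((Matrix.minEnergyOn (H φ) K : ℝ) : ℂ) • ψ₁) ∧ (ψ₂ ∈ K ∧ ψ₂ ≠ 0 ∧ Matrix.mulVec (H φ) ψ₂ = ((Matrix.minEnergyOn (H φ) K : ℝ) : ℂ) • ψ₂) ∧ star ψ₁ ⬝ᵥ ψ₂ = 0) ↔ (|φ 0| = c ∧ |φ 1| = c))) ∧ (∀ p : Fin 2 → ℝ, |p 0| = c → |p 1| = c → ∀ r : ℝ, 0 < r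 → r < min c (Real.pi - c) → ∃ n₀ : ℕ, ∀ n ≥ n₀, ∀ ψ : Fin n → (Finset (Literature.MathematicalPhysics.QuantumLattice.Orb (Literature.MathematicalPhysics.QuantumLattice.FermionTorus 2 L)) → ℂ), (∀ i : Fin n, ((ψ i) ∈ K ∧ (ψ i) ≠ 0 ∧ Matrix.mulVec (H (fun ν : Fin 2 => p ν + r * (if ν = 0 then Real.cos (2 * Real.pi * (i : ℕ) / n) else Real.sin (2 * Real.pi * (i : ℕ) / n)))) (ψ i) = ((Matrix.minEnergyOn (H (fun ν : Fin 2 => p ν + r * (if ν = 0 then Real.cos (2 * Real.pi * (i : ℕ) / n) else Real.sin (2 * Real.pi * (i : ℕ) / n)))) K : ℝ) : ℂ) • (ψ i)) ∧ star (ψ i) ⬝ᵥ ψ i = 1) → (∏ i : Fin n, star (ψ i) ⬝ᵥ ψ (finRotate n i)).re < 0)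

-- earlier BridgeNodalToDWave (stmt-HubbardSuperconductivity-1623, replaced 2026-08-15T16:14:09Z -> stmt-HubbardSuperconductivity-10395): retired by None — ∃ U₀ : ℝ, 0 < U₀ ∧ ∀ U ∈ Set.Ioo (0 : ℝ) U₀, ∀ δ ∈ Set.Icc (1 / 10 : ℝ) (3 / 10), (∃ κ : ℝ, 0 < κ ∧ κ < Real.pi ∧ ∀ ε : ℝ, 0 < ε → ∃ L₀ : ℕ, ∀ (L : ℕ) [NeZero L], Even L → L₀ ≤ L → (∀ m : ℤ, ε ≤ |L * κ - m * Real.pi|) → let sh : Literature.Mathema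
/-- item stmt-HubbardSuperconductivity-10395 · crux · rank 4 · open · by planner
why it might fail: @why1623.txt
sources: ArovasBergKivelsonRaghu2022, RaghuKivelsonScalapino2010, DengEtAl2015, BalentsFisherNayak1998, Literature.Barriers.HubbardSuperconductivity.WeakCouplingCeiling
[crux] Classification bridge at weak coupling: ∃U₀>0 ∀U∈(0,U₀) ∀δ∈[1/10,3/10], NodalDirac(U,δ)
(verbatim the package of NodalDiracWeakCoupling) ⇒ every normalised (N_L,0)-sector ground-state
sequence of hubbardTorus 2 L 1 U has the Statement's even-side d_{x²−y²} pair-field LRO (hypothesis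
and conclusion copied verbatim from
Summits/HubbardSuperconductivity/HubbardSuperconductivity/Statement.lean, so Assembly is pure
logic). Heuristic content: isolated DIAGONAL Dirac points of the fixed-N spectral flow under SPIN
twists at generic filling need a point-like zero set of spin-carrying fermionic excitations with B1g
node geometry and no Fermi surface (a Fermi liquid gives a codimension-1 net, a full gap nothing,
d_xy axial points, extended-s eight generic points); with translation invariance at weak coupling
the only known such state is the d_{x²−y²} condensate, whose nearest-neighbour pair amplitude is
generic (cf. YangSpectral's overlap clause stmt-HubbardSuperconductivity-0179). The resonant-L set
on which NodalDirac is silent must be absorbed here (LRO is a liminf over ALL even L). Sources: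
BalentsFisherNayak1998 (the named competitor), SenthilMarstonFisher1999, ReadGreen2000, Scal -/
@[route_item "route-HubbardSuperconductivity-NodalDiracTwist", crux]
def BridgeNodalToDWave : Prop :=
  ∃ U₀ : ℝ, 0 < U₀ ∧ ∀ U ∈ Set.Ioo (0 : ℝ) U₀, ∀ δ ∈ Set.Icc (1 / 10 : ℝ) (3 / 10), (∃ κ : ℝ, 0 < κ ∧ κ < Real.pi ∧ Real.cos κ ≠ 0 ∧ ∀ ε : ℝ, 0 < ε → ∃ L₀ : ℕ, ∀ (L : ℕ) [NeZero L], Even L → L₀ ≤ L → (∀ m : ℤ, ε ≤ |L * κ - m * Real.pi|) → let sh : Literature.MathematicalPhysics.QuantumLattice.FermionTorus 2 L → Fin 2 → Literature.MathematicalPhysics.QuantumLattice.FermionTorus 2 L := fun x μ => toLex (Function.update (ofLex x) μ (ofLex x μ + 1)); let a := fun (x : Literature.MathematicalPhysics.QuantumLattice.FermionTorus 2 L) (σ : Fin 2) => Literature.MathematicalPhysics.QuantumLattice.annihilation (Literature.MathematicalPhysics.QuantumLattice.orb x σ); let H := fun φ : Fin 2 → ℝ => -(∑ x : Literature.MathematicalPhysics.QuantumLattice.FermionTorus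 2 L, ∑ μ : Fin 2, ∑ σ : Fin 2, (Complex.exp (Complex.I * (((-1 : ℝ) ^ (σ : ℕ) * φ μ / L : ℝ) : ℂ)) • (Matrix.conjTranspose (a x σ) * a (sh x μ) σ) + Complex.exp (-(Complex.I * (((-1 : ℝ) ^ (σ : ℕ) * φ μ / L : ℝ) : ℂ))) • (Matrix.conjTranspose (a (sh x μ) σ) * a x σ))) + (U : ℂ) • ∑ x : Literature.MathematicalPhysics.QuantumLattice.FermionTorus 2 L, Literature.MathematicalPhysics.QuantumLattice.numberOp x 0 * Literature.MathematicalPhysics.QuantumLattice.numberOp x 1; ∃ c : ℝ, 0 < c ∧ c < Real.pi ∧ |Real.cos c - Real.cos (L * κ)| ≤ ε ∧ (∀ φ : Fin 2 → ℝ, φ 0 ∈ Set.Ioc (-Real.pi) Real.pi → φ 1 ∈ Set.Ioc (-Real.pi) Real.pi → ((∃ ψ₁ ψ₂, Literature.MathematicalPhysics.QuantumLattice.IsGroundStateInSector (H φ) (2 * ⌊(1 - δ) * (L : ℝ) ^ 2 / 2⌋₊) 0 ψ₁ ∧ Literature.MathematicalPhysics.QuantumLattice.IsGroundStateInSector (H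 φ) (2 * ⌊(1 - δ) * (L : ℝ) ^ 2 / 2⌋₊) 0 ψ₂ ∧ star ψ₁ ⬝ᵥ ψ₂ = 0) ↔ (|φ 0| = c ∧ |φ 1| = c))) ∧ (∀ p : Fin 2 → ℝ, |p 0| = c → |p 1| = c → ∀ r : ℝ, 0 < r → r < min c (Real.pi - c) → ∃ n₀ : ℕ, ∀ n ≥ n₀, ∀ ψ : Fin n → (Finset (Literature.MathematicalPhysics.QuantumLattice.Orb (Literature.MathematicalPhysics.QuantumLattice.FermionTorus 2 L)) → ℂ), (∀ i : Fin n, Literature.MathematicalPhysics.QuantumLattice.IsGroundStateInSector (H (fun ν : Fin 2 => p ν + r * (if ν = 0 then Real.cos (2 * Real.pi * (i : ℕ) / n) else Real.sin (2 * Real.pi * (i : ℕ) / n)))) (2 * ⌊(1 - δ) * (L : ℝ) ^ 2 / 2⌋₊) 0 (ψ i) ∧ star (ψ i) ⬝ᵥ ψ i = 1) → (∏ i : Fin n, star (ψ i) ⬝ᵥ ψ (finRotate n i)).re < 0)) → ∀ (N : ℕ → ℕ) (ψ : ∀ L, Literature.MathematicalPhysics.QuantumLattice.Fock (Literature.MathematicalPhysics.QuantumLattice.Orb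 (Literature.MathematicalPhysics.QuantumLattice.FermionTorus 2 L))), (∀ L, Even L → N L = 2 * ⌊(1 - δ) * (L : ℝ) ^ 2 / 2⌋₊ ∧ star (ψ L) ⬝ᵥ ψ L = 1 ∧ Literature.MathematicalPhysics.QuantumLattice.IsGroundStateInSector (Literature.MathematicalPhysics.QuantumLattice.hubbardTorus 2 L 1 U) (N L) 0 (ψ L)) → Literature.Probability.LatticeModels.HasLongRangeOrder (fun k => Literature.Probability.LatticeModels.halfOpenBox 2 (2 * k)) (fun k => Literature.MathematicalPhysics.QuantumLattice.torusPullback (Literature.MathematicalPhysics.QuantumLattice.pairFieldCorr Literature.MathematicalPhysics.QuantumLattice.dWaveFormFactor ψ) (2 * k))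

/-- item stmt-HubbardSuperconductivity-1625 · support · rank 9 · closed · proved by Summit.HubbardSuperconductivity.HubbardSuperconductivity.Theorems.NodalDiracTwist.twistCalibrationBdG_proof @ 7b81f61aeb53 (prover) · by planner
[support] BdG calibration, provable now (finite linear algebra per L + the 2×2 real Möbius lemma):
for every L≥3, μ₀∈(−4,4), h≠0 with L·arccos(−μ₀/4)∉πℤ, the U=0 sourced twisted family (same inlined
H as SourcedDiracPersistence with U=0) restricted to ker S^z has its ground state degenerate EXACTLY
at the four diagonal twists (±c,±c) of (−π,π]², with cos c=cos(L·arccos(−μ₀/4)) (positions = L×node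
exactly), and holonomy −1 around each. Proof sketch: boost-gauge Fourier transform (↑ momenta k, ↓
momenta −k) splits H into commuting 4-dimensional blocks (k↑,−k↓) with one-quasiparticle energy
E_k(φ)=√(ξ²+h²ĝ²) at q=k+φ/L, ξ=−2(cos q_x+cos q_y)−μ₀, ĝ=2(cos q_x−cos q_y); E_k=0 ⇔ q∈{(±κ,±κ)},
cos κ=−μ₀/4; non-resonance ⇒ at most one critical block at any φ and c∉{0,π}; the global GS is
⊗(even lower block states), unique and in ker S^z iff all E_k>0; at a critical twist the ker-S^z
ground space is {|0⟩,|pair⟩}_k* (2-dim); the lower eigenvector of the real block −ξσ_z+Δσ_x turns by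
π (sign flip) when (ξ,Δ)(φ) winds once around 0 — index ±1 at the simple zero since ∇_φξ ∥ (1,1) ⊥
∇_φĝ ∥ (−1,1) at a diagonal node — and every other block has winding 0 on a disk containing one
locus point; the m -/
@[route_item "route-HubbardSuperconductivity-NodalDiracTwist"]
def TwistCalibrationBdG : Prop :=
  ∀ (L : ℕ) [NeZero L], 3 ≤ L → ∀ μ₀ h : ℝ, -4 < μ₀ → μ₀ < 4 → h ≠ 0 → (∀ m : ℤ, (L : ℝ) * Real.arccos (-μ₀ / 4) ≠ m * Real.pi) → let sh : Literature.MathematicalPhysics.QuantumLattice.FermionTorus 2 L → Fin 2 → Literature.MathematicalPhysics.QuantumLattice.FermionTorus 2 L := fun x μ => toLex (Function.update (ofLex x) μ (ofLex x μ + 1)); let a := fun (x : Literature.MathematicalPhysics.QuantumLattice.FermionTorus 2 L) (σ : Fin 2) => Literature.MathematicalPhysics.QuantumLattice.annihilation (Literature.MathematicalPhysics.QuantumLattice.orb x σ); let H₀ := fun φ : Fin 2 → ℝ => -(∑ x : Literature.MathematicalPhysics.QuantumLattice.FermionTorus 2 L, ∑ μ : Fin 2, ∑ σ : Fin 2, (Complex.exp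 (Complex.I * (((-1 : ℝ) ^ (σ : ℕ) * φ μ / L : ℝ) : ℂ)) • (Matrix.conjTranspose (a x σ) * a (sh x μ) σ) + Complex.exp (-(Complex.I * (((-1 : ℝ) ^ (σ : ℕ) * φ μ / L : ℝ) : ℂ))) • (Matrix.conjTranspose (a (sh x μ) σ) * a x σ))) + ((0 : ℝ) : ℂ) • ∑ x : Literature.MathematicalPhysics.QuantumLattice.FermionTorus 2 L, Literature.MathematicalPhysics.QuantumLattice.numberOp x 0 * Literature.MathematicalPhysics.QuantumLattice.numberOp x 1; let P := fun φ : Fin 2 → ℝ => ∑ x : Literature.MathematicalPhysics.QuantumLattice.FermionTorus 2 L, ∑ μ : Fin 2, ((-1 : ℂ) ^ (μ : ℕ)) • (Complex.exp (-(Complex.I * ((φ μ / L : ℝ) : ℂ))) • (a x 0 * a (sh x μ) 1) + Complex.exp (Complex.I * ((φ μ / L : ℝ) : ℂ)) • (a (sh x μ) 0 * a x 1)); let H := fun φ : Fin 2 → ℝ => H₀ φ - (μ₀ : ℂ) • Literature.MathematicalPhysics.QuantumLattice.totalNumber - (h : ℂ) • (P φ + Matrix.conjTranspose (P φ)); let K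 := LinearMap.ker (Matrix.toLin' (Literature.MathematicalPhysics.QuantumLattice.HubbardWave0.spinZ : Matrix (Finset (Literature.MathematicalPhysics.QuantumLattice.Orb (Literature.MathematicalPhysics.QuantumLattice.FermionTorus 2 L))) (Finset (Literature.MathematicalPhysics.QuantumLattice.Orb (Literature.MathematicalPhysics.QuantumLattice.FermionTorus 2 L))) ℂ)); ∃ c : ℝ, 0 < c ∧ c < Real.pi ∧ Real.cos c = Real.cos (L * Real.arccos (-μ₀ / 4)) ∧ (∀ φ : Fin 2 → ℝ, φ 0 ∈ Set.Ioc (-Real.pi) Real.pi → φ 1 ∈ Set.Ioc (-Real.pi) Real.pi → ((∃ ψ₁ ψ₂, (ψ₁ ∈ K ∧ ψ₁ ≠ 0 ∧ Matrix.mulVec (H φ) ψ₁ = ((Matrix.minEnergyOn (H φ) K : ℝ) : ℂ) • ψ₁) ∧ (ψ₂ ∈ K ∧ ψ₂ ≠ 0 ∧ Matrix.mulVec (H φ) ψ₂ = ((Matrix.minEnergyOn (H φ) K : ℝ) : ℂ) • ψ₂) ∧ star ψ₁ ⬝ᵥ ψ₂ = 0) ↔ (|φ 0| = c ∧ |φ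 1| = c))) ∧ (∀ p : Fin 2 → ℝ, |p 0| = c → |p 1| = c → ∀ r : ℝ, 0 < r → r < min c (Real.pi - c) → ∃ n₀ : ℕ, ∀ n ≥ n₀, ∀ ψ : Fin n → (Finset (Literature.MathematicalPhysics.QuantumLattice.Orb (Literature.MathematicalPhysics.QuantumLattice.FermionTorus 2 L)) → ℂ), (∀ i : Fin n, ((ψ i) ∈ K ∧ (ψ i) ≠ 0 ∧ Matrix.mulVec (H (fun ν : Fin 2 => p ν + r * (if ν = 0 then Real.cos (2 * Real.pi * (i : ℕ) / n) else Real.sin (2 * Real.pi * (i : ℕ) / n)))) (ψ i) = ((Matrix.minEnergyOn (H (fun ν : Fin 2 => p ν + r * (if ν = 0 then Real.cos (2 * Real.pi * (i : ℕ) / n) else Real.sin (2 * Real.pi * (i : ℕ) / n)))) K : ℝ) : ℂ) • (ψ i)) ∧ star (ψ i) ⬝ᵥ ψ i = 1) → (∏ i : Fin n, star (ψ i) ⬝ᵥ ψ (finRotate n i)).re < 0)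

-- `TwistCalibrationBdG` holds: proved by `Summit.HubbardSuperconductivity.HubbardSuperconductivity.Theorems.NodalDiracTwist.twistCalibrationBdG_proof` @ 7b81f61aeb53 (its module imports this route file, so no `_holds` link can be stated here).

/-- item stmt-HubbardSuperconductivity-1626 · support · rank 9 · closed · proved by Summit.HubbardSuperconductivity.HubbardSuperconductivity.Theorems.NodalDiracTwist.realCyclicOverlap_proof (prover) · by planner
[support] ℤ₂ quantisation lemma: T:=K∘F — complex conjugation in the occupation basis Finset(Orb
Λ)→ℂ composed with the real signed-permutation unitary F induced by the orbital swap (x,σ)↦(x,1−σ)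
(F c†_{xσ} F⁻¹ = c†_{x,1−σ}, F²=1) — is antiunitary with T²=+1, maps szSector N 0 to itself
(S^z→−S^z) and commutes with H_L(U,φ) for every φ (K sends φ→−φ because creation/annihilation are
real matrices; F sends φ→−φ). Hence if at each vertex φ_i of a closed polygon the sector GS is
unique up to scalars, Tψ_i=e^{iα_i}ψ_i and Π_i⟨ψ_i,ψ_{i+1}⟩ = conj(Π_i⟨ψ_i,ψ_{i+1}⟩): the cyclic
overlap product is REAL for any phase choices (its sign, when nonzero, is the ℤ₂ holonomy).
Elementary; the work is constructing F on Fock space (~400–700 Lean lines). Sources: Hatsugai2006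
(ℤ₂ Berry phases from antiunitary symmetry); Tasaki2020 §9.2 (Jordan–Wigner signs). -/
@[route_item "route-HubbardSuperconductivity-NodalDiracTwist"]
def RealCyclicOverlap : Prop :=
  ∀ (L : ℕ) [NeZero L] (U : ℝ) (N n : ℕ) (φs : Fin n → Fin 2 → ℝ) (ψ : Fin n → (Finset (Literature.MathematicalPhysics.QuantumLattice.Orb (Literature.MathematicalPhysics.QuantumLattice.FermionTorus 2 L)) → ℂ)), let sh : Literature.MathematicalPhysics.QuantumLattice.FermionTorus 2 L → Fin 2 → Literature.MathematicalPhysics.QuantumLattice.FermionTorus 2 L := fun x μ => toLex (Function.update (ofLex x) μ (ofLex x μ + 1)); let a := fun (x : Literature.MathematicalPhysics.QuantumLattice.FermionTorus 2 L) (σ : Fin 2) => Literature.MathematicalPhysics.QuantumLattice.annihilation (Literature.MathematicalPhysics.QuantumLattice.orb x σ); let H := fun φ : Fin 2 → ℝ => -(∑ x : Literature.MathematicalPhysics.QuantumLattice.FermionTorus 2 L, ∑ μ : Fin 2, ∑ σ : Fin 2, (Complex.exp (Complex.I * (((-1 : ℝ) ^ (σ : ℕ) * φ μ / L : ℝ)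 : ℂ)) • (Matrix.conjTranspose (a x σ) * a (sh x μ) σ) + Complex.exp (-(Complex.I * (((-1 : ℝ) ^ (σ : ℕ) * φ μ / L : ℝ) : ℂ))) • (Matrix.conjTranspose (a (sh x μ) σ) * a x σ))) + (U : ℂ) • ∑ x : Literature.MathematicalPhysics.QuantumLattice.FermionTorus 2 L, Literature.MathematicalPhysics.QuantumLattice.numberOp x 0 * Literature.MathematicalPhysics.QuantumLattice.numberOp x 1; (∀ i : Fin n, Literature.MathematicalPhysics.QuantumLattice.IsGroundStateInSector (H (φs i)) N 0 (ψ i)) → (∀ (i : Fin n) χ, Literature.MathematicalPhysics.QuantumLattice.IsGroundStateInSector (H (φs i)) N 0 χ → ∃ z : ℂ, χ = z • ψ i) → (∏ i : Fin n, star (ψ i) ⬝ᵥ ψ (finRotate n i)).im = 0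

-- `RealCyclicOverlap` holds: proved by `Summit.HubbardSuperconductivity.HubbardSuperconductivity.Theorems.NodalDiracTwist.realCyclicOverlap_proof` (its module imports this route file, so no `_holds` link can be stated here).

/-- item stmt-HubbardSuperconductivity-1627 · support · rank 9 · closed · proved by Summit.HubbardSuperconductivity.HubbardSuperconductivity.Theorems.NodalDiracTwist.diskTrivialHolonomy_proof @ c61ec1ae1dc3 (prover) · by planner
[support] The instrument lemma (stability of Dirac points): if the (N,0)-sector GS of H_L(U,φ) is
unique on the CLOSED disk |φ−p|≤r, then for all fine discretisations of its boundary circle and any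
unit GS choices the cyclic overlap product has POSITIVE real part. Contrapositive: Re Π<0 on a loop
certifies a degeneracy inside the loop — holonomy −1 points can move under perturbation but cannot
open (von Neumann–Wigner codimension 2 for real families). Proof sketch: uniqueness on a compact
disk ⇒ uniform gap ⇒ the GS projector is real-analytic in φ (Riesz projection of the analytic family
H_L(U,·)); T-reality (RealCyclicOverlap) ⇒ a T-real local unit section has vanishing Berry
connection (flat); the disk is simply connected ⇒ a global smooth T-real unit section s exists; Π
over arbitrary unit choices = Π⟨s_i,s_{i+1}⟩ = Π(1−½‖s_i−s_{i+1}‖²) ≥ 1−C(2πr)²/n → 1. Needs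
finite-dimensional analytic perturbation theory of a simple eigenvalue (little Mathlib support:
substantial, ~1.5–3k lines). Sources: NiuThoulessWu1985; Hatsugai2006; FukuiHatsugaiSuzuki2005
(lattice link variables). -/
@[route_item "route-HubbardSuperconductivity-NodalDiracTwist"]
def DiskTrivialHolonomy : Prop :=
  ∀ (L : ℕ) [NeZero L] (U : ℝ) (N : ℕ) (p : Fin 2 → ℝ) (r : ℝ), 0 < r → let sh : Literature.MathematicalPhysics.QuantumLattice.FermionTorus 2 L → Fin 2 → Literature.MathematicalPhysics.QuantumLattice.FermionTorus 2 L := fun x μ => toLex (Function.update (ofLex x) μ (ofLex x μ + 1)); let a := fun (x : Literature.MathematicalPhysics.QuantumLattice.FermionTorus 2 L) (σ : Fin 2) => Literature.MathematicalPhysics.QuantumLattice.annihilation (Literature.MathematicalPhysics.QuantumLattice.orb x σ); let H := fun φ : Fin 2 → ℝ => -(∑ x : Literature.MathematicalPhysics.QuantumLattice.FermionTorus 2 L, ∑ μ : Fin 2, ∑ σ : Fin 2, (Complex.exp (Complex.I * (((-1 : ℝ) ^ (σ : ℕ) * φ μ / L : ℝ) : ℂ)) • (Matrix.conjTranspose (a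 x σ) * a (sh x μ) σ) + Complex.exp (-(Complex.I * (((-1 : ℝ) ^ (σ : ℕ) * φ μ / L : ℝ) : ℂ))) • (Matrix.conjTranspose (a (sh x μ) σ) * a x σ))) + (U : ℂ) • ∑ x : Literature.MathematicalPhysics.QuantumLattice.FermionTorus 2 L, Literature.MathematicalPhysics.QuantumLattice.numberOp x 0 * Literature.MathematicalPhysics.QuantumLattice.numberOp x 1; (∀ φ : Fin 2 → ℝ, (φ 0 - p 0) ^ 2 + (φ 1 - p 1) ^ 2 ≤ r ^ 2 → ∀ χ₁ χ₂, Literature.MathematicalPhysics.QuantumLattice.IsGroundStateInSector (H φ) N 0 χ₁ → Literature.MathematicalPhysics.QuantumLattice.IsGroundStateInSector (H φ) N 0 χ₂ → ∃ z : ℂ, χ₂ = z • χ₁) → ∃ n₀ : ℕ, ∀ n ≥ n₀, ∀ ψ : Fin n → (Finset (Literature.MathematicalPhysics.QuantumLattice.Orb (Literature.MathematicalPhysics.QuantumLattice.FermionTorus 2 L)) → ℂ), (∀ i : Fin n, Literature.MathematicalPhysics.QuantumLattice.IsGroundStateInSector (H (fun ν : Fin 2 => p ν + r * (if ν = 0 then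 Real.cos (2 * Real.pi * (i : ℕ) / n) else Real.sin (2 * Real.pi * (i : ℕ) / n)))) N 0 (ψ i) ∧ star (ψ i) ⬝ᵥ ψ i = 1) → 0 < (∏ i : Fin n, star (ψ i) ⬝ᵥ ψ (finRotate n i)).re

-- `DiskTrivialHolonomy` holds: proved by `Summit.HubbardSuperconductivity.HubbardSuperconductivity.Theorems.NodalDiracTwist.diskTrivialHolonomy_proof` @ c61ec1ae1dc3 (its module imports this route file, so no `_holds` link can be stated here).

/-- item stmt-HubbardSuperconductivity-1628 · support · rank 9 · closed · proved by Summit.HubbardSuperconductivity.HubbardSuperconductivity.Theorems.NodalDiracTwist.twistAtZero_proof (prover) · by planner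
[support] Bookkeeping tying the inlined twisted family to the Statement's Hamiltonian: for L≥3 (so
that x+e_μ≠x−e_μ on (ℤ/L)²) and φ=0 every phase is exp(0)=1 and
−Σ_xΣ_μΣ_σ(c†_{xσ}c_{x+e_μ,σ}+c†_{x+e_μ,σ}c_{xσ}) re-indexes to the ordered-adjacent-pair sum
−Σ_{x,y}Σ_σ[fermionTorusGraph 2 L adj x y]c†_{xσ}c_{yσ} of
Literature.MathematicalPhysics.QuantumLattice.hamiltonian, i.e. twistH = hubbardTorus 2 L 1 U as
matrices. Finset.sum manipulations + fermionTorusGraph_adj unfolding; cheap. (For L=2 the inlined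
family double counts the bond; irrelevant, all cruxes are at large L.) Sources: Lieb1989 (model),
Tasaki2020 §10. -/
@[route_item "route-HubbardSuperconductivity-NodalDiracTwist"]
def TwistAtZero : Prop :=
  ∀ (L : ℕ) [NeZero L], 3 ≤ L → ∀ U : ℝ, let sh : Literature.MathematicalPhysics.QuantumLattice.FermionTorus 2 L → Fin 2 → Literature.MathematicalPhysics.QuantumLattice.FermionTorus 2 L := fun x μ => toLex (Function.update (ofLex x) μ (ofLex x μ + 1)); let a := fun (x : Literature.MathematicalPhysics.QuantumLattice.FermionTorus 2 L) (σ : Fin 2) => Literature.MathematicalPhysics.QuantumLattice.annihilation (Literature.MathematicalPhysics.QuantumLattice.orb x σ); let H := fun φ : Fin 2 → ℝ => -(∑ x : Literature.MathematicalPhysics.QuantumLattice.FermionTorus 2 L, ∑ μ : Fin 2, ∑ σ : Fin 2, (Complex.exp (Complex.I * (((-1 : ℝ) ^ (σ : ℕ) * φ μ / L : ℝ) : ℂ)) • (Matrix.conjTranspose (a x σ) * a (sh x μ) σ) + Complex.exp (-(Complex.I * (((-1 : ℝ) ^ (σ : ℕ) * φ μ / L : ℝ) : ℂ))) • (Matrix.conjTranspose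 (a (sh x μ) σ) * a x σ))) + (U : ℂ) • ∑ x : Literature.MathematicalPhysics.QuantumLattice.FermionTorus 2 L, Literature.MathematicalPhysics.QuantumLattice.numberOp x 0 * Literature.MathematicalPhysics.QuantumLattice.numberOp x 1; H 0 = Literature.MathematicalPhysics.QuantumLattice.hubbardTorus 2 L 1 U

-- `TwistAtZero` holds: proved by `Summit.HubbardSuperconductivity.HubbardSuperconductivity.Theorems.NodalDiracTwist.twistAtZero_proof` (its module imports this route file, so no `_holds` link can be stated here).

/-- item stmt-HubbardSuperconductivity-1624 · assembly · rank 1 · closed · proved by Summit.HubbardSuperconductivity.HubbardSuperconductivity.Theorems.nodalDiracTwist_assembly_proof (prover) · by planner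
[assembly] Pure logic, checked rc0 in the planner folder (Sketch.lean `assembly_holds`, 6 lines):
take U₀ from BridgeNodalToDWave; NodalDiracWeakCoupling at that U₀ gives U∈(0,U₀),
δ∈[1/10,3/10]⊂(0,1/2) with NodalDirac(U,δ); the bridge yields the Statement body ∀N ψ,
HYP→HasLongRangeOrder(…). SourcedDiracPersistence is carried as the controlled rung / kill criterion
and is not used logically. -/
@[route_item "route-HubbardSuperconductivity-NodalDiracTwist"]
def Assembly : Prop :=
  NodalDiracWeakCoupling → SourcedDiracPersistence → BridgeNodalToDWave → HubbardSuperconductivity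

-- `Assembly` holds: proved by `Summit.HubbardSuperconductivity.HubbardSuperconductivity.Theorems.nodalDiracTwist_assembly_proof` (its module imports this route file, so no `_holds` link can be stated here).

/-! D-0027 §2.1 — DECIDING THEOREM (planner-authored via `route open/edit --closes-file`; by planner-rbadge-HubbardSuperconductivity-NodalD-ec5b2c6a-g2-0 2026-08-15T16:14:38Z):
its hypotheses are this route's items and its conclusion the sub-problem Statement (glue_lint), and it elaborates with this file. -/

/-- Deciding theorem (D-0027 §2.1): the route's items imply the summit statement by pure logic —
take `U₀` from `BridgeNodalToDWave`, then `(U, δ)` with `NodalDirac(U,δ)` from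
`NodalDiracWeakCoupling` at that `U₀`; `[1/10, 3/10] ⊂ (0, 1/2)`; the bridge yields the Statement
body verbatim. `SourcedDiracPersistence` is the controlled rung (kill criterion), carried as in
`Assembly` and not used logically. -/
@[closes "route-HubbardSuperconductivity-NodalDiracTwist"] theorem closes (h₁ : NodalDiracWeakCoupling) (_h₂ : SourcedDiracPersistence)
    (h₃ : BridgeNodalToDWave) : HubbardSuperconductivity := by
  obtain ⟨U₀, hU₀, hB⟩ := h₃
  obtain ⟨U, hU, δ, hδ, hND⟩ := h₁ U₀ hU₀
  show Literature.Hubbard.DWaveSuperconductivityHubbard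
  exact ⟨U, hU.1, δ, ⟨by linarith [hδ.1], by linarith [hδ.2]⟩, hB U hU δ hδ hND⟩

end Summit.HubbardSuperconductivity.HubbardSuperconductivity.Theses.NodalDiracTwist
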